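import Summits.AtomisticToContinuum.HydrodynamicLimit.Theorems.HydroLimitInBand.Negative.EquilibriumRigidity
import HarnessLib

/-!
# `HydroLimitInBand` (crux stmt-AtomisticToContinuum-9133), negative side: LOAD-BEARING ANALYSIS I

Standing disprover's lemmas (`Cruxes/HydroLimitInBand/Disproof.lean` §2–§3, refuter-cdisprove-stmt-AtomisticToContinuum-9133-0).
"ANY PROOF OF THE CRUX MUST USE H": for each field `H` of `IsHardSphereEulerSolution`, the crux with `H` dropped is FALSE.
This file: the crux shape over an arbitrary solution class (`InBandFor Sol`; `hydroLimitInBand_iff_inBandFor`), the master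
refutation lemma `not_inBandFor_of_witness` (a class admitting, at every small `σ`, a member with equilibrium data `(1,0,1)`,
packing `< η₀` and a non-constant continuous slice is refuted on homogeneous profiles by equilibrium rigidity,
`Negative/EquilibriumRigidity.lean`), the junk-derivative calculus of the torus time derivative within `[0,T)`, and the first two
instances: the MASS equation (`ρ = 1+t, θ = 1/(1+t)`: momentum and energy balance hold, mass is created) and the MOMENTUM
equation (`u = t e₀, θ = 1 − t²/3`: mass and energy balance hold, the gas accelerates) are load-bearing. Part II
(`Negative/LoadBearingII.lean`): energy, smoothness, the `t = 0` tie, and the guard.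
-/

noncomputable section

open MeasureTheory Filter Set Topology
open scoped ENNReal

namespace Summit.AtomisticToContinuum.HydrodynamicLimit.Theorems

open Literature.MathematicalPhysics.KineticTheory Literature.Analysis.FluidPDE
open Literature.Analysis.FunctionSpaces
open Summit.AtomisticToContinuum.HydrodynamicLimit.Theses.ImplosionDichotomy (HydroLimitInBand)
open PolynomialCompressionPDE (Flows flows_nonempty)

namespace HydroLimitInBandNegative

/-- A solution class: a predicate on `(σ, T, ρ, u, θ)` (e.g. `IsHardSphereEulerSolution`, or the same
`structure` with one field dropped). -/
abbrev SolClass : Type :=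
  ℝ → ℝ → (ℝ → T3 → ℝ) → (ℝ → T3 → V3) → (ℝ → T3 → ℝ) → Prop

/-- **The crux shape over a solution class `Sol`**: `HydroLimitInBand` with `IsHardSphereEulerSolution`
replaced by `Sol` (everything else verbatim). -/
def InBandFor (Sol : SolClass) : Prop :=
  ∃ η₀ : ℝ, 0 < η₀ ∧ ∀ (a₀ θ₀ : T3 → ℝ) (u₀ : T3 → V3), Continuous a₀ → Continuous θ₀ → Continuous u₀ →
    (∀ x, 0 < a₀ x) → (∀ x, 0 < θ₀ x) → ∃ σ₀ : ℝ, 0 < σ₀ ∧ ∀ σ : ℝ, 0 < σ → σ < σ₀ →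
    ∀ (T : ℝ) (ρ θ : ℝ → T3 → ℝ) (u : ℝ → T3 → V3), Sol σ T ρ u θ →
    (∀ t ∈ Ico 0 T, ∀ x, ρ t x * σ ^ 3 < η₀) →
    ∀ Φ : Flows σ, TendstoHydroFieldsAt (fun N => localGibbsLaw σ a₀ u₀ θ₀ N (Φ N)) Φ ρ u θ 0 →
    ∀ t ∈ Ico 0 T, TendstoHydroFieldsAt (fun N => localGibbsLaw σ a₀ u₀ θ₀ N (Φ N)) Φ ρ u θ t

/-- The crux is `InBandFor IsHardSphereEulerSolution` (definitionally). -/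
theorem hydroLimitInBand_iff_inBandFor : HydroLimitInBand ↔ InBandFor IsHardSphereEulerSolution :=
  Iff.rfl

/-- **Master refutation lemma.** If a solution class `Sol` admits, for every guard `η₀ > 0` and below every
threshold, a member at some `0 < σ` with packing `< η₀`, equilibrium data `(1, 0, 1)` at `t = 0`, and a
time `t ∈ [0, T)` at which its (continuous) slices are NOT the constant state `(1, 0, 1)`, then the guarded
LLN transfer `InBandFor Sol` fails: test it on the homogeneous profiles `(1, 0, 1)`, where the data are tied
(package (ii)), flows exist (Alexander), and rigidity (package (iii)) forbids non-constant targets. -/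
theorem not_inBandFor_of_witness {Sol : SolClass}
    (W : ∀ η₀ : ℝ, 0 < η₀ → ∀ σ₁ : ℝ, 0 < σ₁ → ∃ σ : ℝ, 0 < σ ∧ σ < σ₁ ∧
      ∃ (T : ℝ) (ρ θ : ℝ → T3 → ℝ) (u : ℝ → T3 → V3), Sol σ T ρ u θ ∧
        (∀ t ∈ Ico 0 T, ∀ x, ρ t x * σ ^ 3 < η₀) ∧
        ρ 0 = (fun _ => 1) ∧ u 0 = (fun _ => 0) ∧ θ 0 = (fun _ => 1) ∧
        ∃ t ∈ Ico 0 T, Continuous (ρ t) ∧ Continuous (u t) ∧ Continuous (θ t) ∧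
          ¬ (ρ t = (fun _ => 1) ∧ u t = (fun _ => 0) ∧ θ t = (fun _ => 1))) :
    ¬ InBandFor Sol := by
  rintro ⟨η₀, hη₀, H⟩
  obtain ⟨σ₀, hσ₀, G⟩ := H (fun _ => 1) (fun _ => 1) (fun _ => 0) continuous_const continuous_const
    continuous_const (fun _ => one_pos) (fun _ => one_pos)
  obtain ⟨σ₁, hσ₁, hσ₁2, P⟩ := equilibrium_package (a := 1) (θc := 1) (0 : V3) one_pos one_pos
  obtain ⟨σ, hσ, hσlt, T, ρ, θ, u, hSol, hguard, h1, h2, h3, t, ht, hρc, huc, hθc, hne⟩ :=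
    W η₀ hη₀ (min σ₀ σ₁) (lt_min hσ₀ hσ₁)
  have hσ₀' : σ < σ₀ := lt_of_lt_of_le hσlt (min_le_left _ _)
  have hσ₁' : σ < σ₁ := lt_of_lt_of_le hσlt (min_le_right _ _)
  obtain ⟨Φ⟩ := flows_nonempty hσ (hσ₁'.trans_le hσ₁2)
  obtain ⟨-, htie, hrig⟩ := P σ hσ hσ₁' Φ
  have h0 := htie ρ θ u h1 h2 h3
  have hT := G σ hσ hσ₀' T ρ θ u hSol hguard Φ h0 t ht
  exact hne (hrig ρ θ u t hρc huc hθc hT)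

/-! ## Load-bearing analysis: drop one hypothesis at a time -/

section Calculus

/-- A junk-derivative lemma for the time derivative WITHIN `[0, T)`: a function equal to the constant `c` on
the open interval `(0, T)` has `derivWithin f (Ico 0 T) t = 0` at EVERY `t ∈ [0, T)` — at `t > 0` it is
locally constant, and at `t = 0` it is either constant on `[0,T)` (if `f 0 = c`) or DISCONTINUOUS within
`[0, T)`, where Mathlib's `derivWithin` returns the junk value `0`. [folklore] -/
theorem derivWithin_Ico_eq_zero_of_eqOn_Ioo {F : Type*} [NormedAddCommGroup F] [NormedSpace ℝ F]
    {f : ℝ → F} {T : ℝ} {c : F} (hT : 0 < T)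
    (hf : ∀ τ ∈ Ioo 0 T, f τ = c) {t : ℝ} (ht : t ∈ Ico 0 T) : derivWithin f (Ico 0 T) t = 0 := by
  rcases eq_or_lt_of_le ht.1 with h0t | hpos
  · subst h0t
    by_cases h0 : f 0 = c
    · have heq : EqOn f (fun _ => c) (Ico 0 T) := by
        intro τ hτ
        rcases eq_or_lt_of_le hτ.1 with h | h
        · subst h; exact h0
        · exact hf τ ⟨h, hτ.2⟩
      rw [derivWithin_congr heq h0]
      simp
    · refine derivWithin_zero_of_not_differentiableWithinAt fun hd => h0 ?_
      have hc : Tendsto f (𝓝[Ioo 0 T] 0) (𝓝 (f 0)) :=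
        hd.continuousWithinAt.tendsto.mono_left (nhdsWithin_mono _ Ioo_subset_Ico_self)
      have hc' : Tendsto (fun _ : ℝ => c) (𝓝[Ioo 0 T] 0) (𝓝 (f 0)) :=
        hc.congr' (eventually_mem_nhdsWithin.mono fun τ hτ => hf τ hτ)
      haveI : (𝓝[Ioo 0 T] (0 : ℝ)).NeBot := by
        rw [nhdsWithin_Ioo_eq_nhdsGT hT]; infer_instance
      exact tendsto_nhds_unique hc' tendsto_const_nhds
  · have hmem : Ioo 0 T ∈ 𝓝 t := Ioo_mem_nhds hpos ht.2
    rw [derivWithin_of_mem_nhds (mem_of_superset hmem Ioo_subset_Ico_self)]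
    have hev : f =ᶠ[𝓝 t] fun _ => c := eventuallyEq_of_mem hmem fun τ hτ => hf τ hτ
    rw [hev.deriv_eq]
    exact deriv_const t c

/-- The time derivative of a field that is constant in space AND time vanishes (no junk: a constant function is
differentiable within any set). [folklore] -/
@[simp] theorem timeDerivWithin_const' {F : Type*} [NormedAddCommGroup F] [NormedSpace ℝ F] (S : Set ℝ)
    (c : F) (t : ℝ) (x : T3) : Torus.timeDerivWithin S (fun (_ : ℝ) (_ : T3) => c) t x = 0 := by
  simp [Torus.timeDerivWithin]

/-- Spatial derivatives of fields that do not depend on `x` vanish: divergence. [folklore] -/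
@[simp] theorem torusDivergence_const (v : V3) (x : T3) : Torus.divergence (fun _ : T3 => v) x = 0 := by
  simp [Torus.divergence, Torus.partialDeriv, Torus.lineDeriv]

/-- Spatial derivatives of fields that do not depend on `x` vanish: partial derivatives. [folklore] -/
@[simp] theorem torusPartialDeriv_const (i : Fin 3) (v : V3) (x : T3) :
    Torus.partialDeriv i (fun _ : T3 => v) x = 0 := by
  simp [Torus.partialDeriv, Torus.lineDeriv]

/-- Spatial derivatives of fields that do not depend on `x` vanish: gradient. [folklore] -/
@[simp] theorem torusGradient_const (c : ℝ) (x : T3) : Torus.gradient (fun _ : T3 => c) x = 0 := by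
  unfold Torus.gradient Torus.liftAt
  exact gradient_fun_const 0 c

/-- A unit vector of `ℝ³`. -/
def e₀ : V3 := EuclideanSpace.single 0 1

/-- Auxiliary (`norm_e₀`). [folklore] -/
@[simp] theorem norm_e₀ : ‖e₀‖ = 1 := by simp [e₀]

/-- Auxiliary (`e₀_apply_zero`). [folklore] -/
theorem e₀_apply_zero : e₀ 0 = 1 := by simp [e₀]

end Calculus

/-! ### §3.1 Without the mass equation -/

/-- `IsHardSphereEulerSolution` with the MASS equation dropped (all other fields verbatim). -/
def SolWithoutMass : SolClass := fun σ T ρ u θ =>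
  Torus.IsSmoothSpaceTimeOn (Ico 0 T) ρ ∧ Torus.IsSmoothSpaceTimeOn (Ico 0 T) u ∧
  Torus.IsSmoothSpaceTimeOn (Ico 0 T) θ ∧ (∀ t ∈ Ico 0 T, ∀ x, 0 < ρ t x) ∧ (∀ t ∈ Ico 0 T, ∀ x, 0 < θ t x) ∧
  (∀ t ∈ Ico 0 T, ∀ x,
    Torus.timeDerivWithin (Ico 0 T) (fun s y => ρ s y • u s y) t x +
      (∑ i, Torus.partialDeriv i (fun y => (ρ t y * u t y i) • u t y) x) +
      Torus.gradient (fun y => hsPressure σ (ρ t y) (θ t y)) x = 0) ∧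
  (∀ t ∈ Ico 0 T, ∀ x,
    Torus.timeDerivWithin (Ico 0 T) (fun s y => totalEnergyDensity (ρ s y) (u s y) (θ s y)) t x +
      Torus.divergence (fun y => (totalEnergyDensity (ρ t y) (u t y) (θ t y) + hsPressure σ (ρ t y) (θ t y)) •
        u t y) x = 0)

/-- The crux without the mass equation. -/
def HydroLimitInBandWithoutMass : Prop := InBandFor SolWithoutMass

/-- A classical solution is in particular a solution-without-mass (so `HydroLimitInBandWithoutMass →
HydroLimitInBand`: the dropped version is the STRONGER statement). -/
theorem solWithoutMass_of_isSolution {σ T : ℝ} {ρ θ : ℝ → T3 → ℝ} {u : ℝ → T3 → V3}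
    (h : IsHardSphereEulerSolution σ T ρ u θ) : SolWithoutMass σ T ρ u θ :=
  ⟨h.smooth_density, h.smooth_velocity, h.smooth_temperature, h.density_pos, h.temperature_pos, h.momentum,
    h.energy⟩

/-- Choosing `σ` below a threshold and with `2 σ³ < η₀`. -/
theorem exists_sigma_small (η₀ σ₁ : ℝ) (hη₀ : 0 < η₀) (hσ₁ : 0 < σ₁) :
    ∃ σ : ℝ, 0 < σ ∧ σ < σ₁ ∧ 2 * σ ^ 3 < η₀ := by
  set σ := min (σ₁ / 2) (min (1 / 2) (η₀ / 4)) with hσdef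
  have hσpos : 0 < σ := lt_min (by positivity) (lt_min (by norm_num) (by positivity))
  have h1 : σ ≤ σ₁ / 2 := min_le_left _ _
  have h2 : σ ≤ 1 / 2 := (min_le_right _ _).trans (min_le_left _ _)
  have h3 : σ ≤ η₀ / 4 := (min_le_right _ _).trans (min_le_right _ _)
  have hcube : σ ^ 3 ≤ σ := by
    have := pow_le_pow_of_le_one hσpos.le (by linarith) (show 1 ≤ 3 by norm_num)
    simpa using this
  exact ⟨σ, hσpos, by linarith, by linarith⟩

/-- **The mass equation is load-bearing**: `ρ_t ≡ 1 + t`, `u ≡ 0`, `θ_t ≡ 1/(1+t)` on `[0, 1)` is smooth,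
positive, satisfies the momentum equation (`∇p = 0`, `ρu ≡ 0`) and the energy equation (`E = (3/2)ρθ ≡ 3/2`),
has equilibrium data `(1, 0, 1)` and packing `≤ 2σ³`, but its density at `t = 1/2` is `3/2 ≠ 1`: under the
homogeneous Gibbs law the (conserved, `χ ≡ 1`) empirical mass cannot follow it. -/
theorem hydroLimitInBand_false_without_mass : ¬ HydroLimitInBandWithoutMass := by
  refine not_inBandFor_of_witness fun η₀ hη₀ σ₁ hσ₁ => ?_
  obtain ⟨σ, hσ, hσlt, hσcube⟩ := exists_sigma_small η₀ σ₁ hη₀ hσ₁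
  have hσ3 : 0 ≤ σ ^ 3 := by positivity
  refine ⟨σ, hσ, hσlt, 1, fun t _ => 1 + t, fun t _ => (1 + t)⁻¹, fun _ _ => 0, ?_, ?_, ?_, ?_, ?_,
    1 / 2, ⟨by norm_num, by norm_num⟩, continuous_const, continuous_const, continuous_const, ?_⟩
  · dsimp only [SolWithoutMass]
    refine ⟨?_, contDiffOn_const, ?_, ?_, ?_, ?_, ?_⟩
    · -- smoothness of `(t, y) ↦ 1 + t`
      exact (contDiff_const.add contDiff_fst).contDiffOn
    · -- smoothness of `(t, y) ↦ (1 + t)⁻¹` on `[0,1) × ℝ³`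
      refine ((contDiff_const.add contDiff_fst).contDiffOn).inv fun p hp => ?_
      have : (0 : ℝ) ≤ p.1 := (Set.mem_prod.1 hp).1.1
      change (1 : ℝ) + p.1 ≠ 0
      exact (by linarith : (0 : ℝ) < 1 + p.1).ne'
    · intro t ht x; linarith [ht.1]
    · intro t ht x
      have : (0 : ℝ) < 1 + t := by linarith [ht.1]
      exact inv_pos.2 this
    · -- momentum: every term vanishes
      intro t ht x
      simp
    · -- energy: `E ≡ 3/2` on `[0,1)`, no transport
      intro t ht x
      simp only [smul_zero, torusDivergence_const, add_zero, Torus.timeDerivWithin]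
      refine derivWithin_Ico_eq_zero_of_eqOn_Ioo one_pos (c := (3 / 2 : ℝ)) (fun τ hτ => ?_) ht
      have hτ' : (1 : ℝ) + τ ≠ 0 := (by linarith [hτ.1] : (0 : ℝ) < 1 + τ).ne'
      simp only [totalEnergyDensity, norm_zero]
      field_simp
      ring
  · intro t ht x
    calc (1 + t) * σ ^ 3 ≤ 2 * σ ^ 3 := mul_le_mul_of_nonneg_right (by linarith [ht.2]) hσ3
      _ < η₀ := hσcube
  · funext x; norm_num
  · rfl
  · funext x; norm_num
  · rintro ⟨h, -, -⟩
    have := congrFun h (0 : T3)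
    norm_num at this

/-! ### §3.2 Without the momentum equation -/

/-- `IsHardSphereEulerSolution` with the MOMENTUM equation dropped. -/
def SolWithoutMomentum : SolClass := fun σ T ρ u θ =>
  Torus.IsSmoothSpaceTimeOn (Ico 0 T) ρ ∧ Torus.IsSmoothSpaceTimeOn (Ico 0 T) u ∧
  Torus.IsSmoothSpaceTimeOn (Ico 0 T) θ ∧ (∀ t ∈ Ico 0 T, ∀ x, 0 < ρ t x) ∧ (∀ t ∈ Ico 0 T, ∀ x, 0 < θ t x) ∧
  (∀ t ∈ Ico 0 T, ∀ x,
    Torus.timeDerivWithin (Ico 0 T) ρ t x + Torus.divergence (fun y => ρ t y • u t y) x = 0) ∧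
  (∀ t ∈ Ico 0 T, ∀ x,
    Torus.timeDerivWithin (Ico 0 T) (fun s y => totalEnergyDensity (ρ s y) (u s y) (θ s y)) t x +
      Torus.divergence (fun y => (totalEnergyDensity (ρ t y) (u t y) (θ t y) + hsPressure σ (ρ t y) (θ t y)) •
        u t y) x = 0)

/-- The crux without the momentum equation. -/
def HydroLimitInBandWithoutMomentum : Prop := InBandFor SolWithoutMomentum

/-- Auxiliary (`solWithoutMomentum_of_isSolution`). [folklore] -/
theorem solWithoutMomentum_of_isSolution {σ T : ℝ} {ρ θ : ℝ → T3 → ℝ} {u : ℝ → T3 → V3}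
    (h : IsHardSphereEulerSolution σ T ρ u θ) : SolWithoutMomentum σ T ρ u θ :=
  ⟨h.smooth_density, h.smooth_velocity, h.smooth_temperature, h.density_pos, h.temperature_pos, h.mass,
    h.energy⟩

/-- **The momentum equation is load-bearing**: the uniformly ACCELERATING homogeneous state `ρ ≡ 1`,
`u_t ≡ t e₀`, `θ_t ≡ 1 − t²/3` on `[0, 1)` conserves mass and total energy (`E ≡ 3/2`) but not momentum; it has
equilibrium data `(1, 0, 1)`, packing `σ³`, and `u_{1/2} ≠ 0`, while the particle momentum (`χ ≡ 1`) is
conserved. -/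
theorem hydroLimitInBand_false_without_momentum : ¬ HydroLimitInBandWithoutMomentum := by
  refine not_inBandFor_of_witness fun η₀ hη₀ σ₁ hσ₁ => ?_
  obtain ⟨σ, hσ, hσlt, hσcube⟩ := exists_sigma_small η₀ σ₁ hη₀ hσ₁
  have hσ3 : 0 ≤ σ ^ 3 := by positivity
  refine ⟨σ, hσ, hσlt, 1, fun _ _ => 1, fun t _ => 1 - t ^ 2 / 3, fun t _ => t • e₀, ?_, ?_, ?_, ?_, ?_,
    1 / 2, ⟨by norm_num, by norm_num⟩, continuous_const, continuous_const, continuous_const, ?_⟩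
  · dsimp only [SolWithoutMomentum]
    refine ⟨contDiffOn_const, ?_, ?_, ?_, ?_, ?_, ?_⟩
    · exact (contDiff_fst.smul contDiff_const).contDiffOn
    · exact (contDiff_const.sub ((contDiff_fst.pow 2).div_const 3)).contDiffOn
    · intro t _ x; exact one_pos
    · intro t ht x
      have : t ^ 2 < 1 := by nlinarith [ht.1, ht.2]
      linarith
    · -- mass: `ρ ≡ 1`, `ρu` does not depend on `x`
      intro t ht x
      simp
    · -- energy: `E ≡ 3/2`, the flux does not depend on `x`
      intro t ht x
      simp only [torusDivergence_const, add_zero, Torus.timeDerivWithin]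
      refine derivWithin_Ico_eq_zero_of_eqOn_Ioo one_pos (c := (3 / 2 : ℝ)) (fun τ _ => ?_) ht
      simp only [totalEnergyDensity, norm_smul, norm_e₀, Real.norm_eq_abs, mul_one, sq_abs]
      ring
  · intro t _ x
    linarith
  · rfl
  · funext x; simp
  · funext x; norm_num
  · rintro ⟨-, h, -⟩
    have h' := congrArg (fun v : V3 => v 0) (congrFun h (0 : T3))
    simp [e₀] at h'


end HydroLimitInBandNegative

end Summit.AtomisticToContinuum.HydrodynamicLimit.Theorems

end
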